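import Summits.ValiantsHypothesis.ValiantsHypothesis.Theorems.LacunarySymmetroidMatrixDescartesCensusM9K5GF112C1
import Summits.ValiantsHypothesis.ValiantsHypothesis.Theorems.LacunarySymmetroidMatrixDescartesCensusM9K5GF112C2
import Summits.ValiantsHypothesis.ValiantsHypothesis.Theorems.LacunarySymmetroidMatrixDescartesCensusM9K5GF112C3
import Summits.ValiantsHypothesis.ValiantsHypothesis.Theorems.LacunarySymmetroidMatrixDescartesCensusM9K5GF112C4
import Summits.ValiantsHypothesis.ValiantsHypothesis.Theorems.LacunarySymmetroidMatrixDescartesCensusM9K5GF112C5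
import Summits.ValiantsHypothesis.ValiantsHypothesis.Theorems.LacunarySymmetroidMatrixDescartesCensusM9K5GF112C6

/-!
# `MatrixDescartes` census certificate `M9K5GF112` (by reflection, 6 Gaussian chunks): format `(m, K) = (9, 5)`, `112 ≤ Z₊` — hence `ζ_sym(9,5) ≥ 112`

HONEST FRAMING.  Assembles the 6 kernel-checked chunks `…CensusM9K5GF112C1..C6` (each a closed `chunkCheckG … = true` on its share of
the 113 rational test points, consecutive chunks sharing their junction point) into the lower bound `112 ≤` number of distinct
positive real zeros of `det (∑ l, X ^ (d l) • S l)` for ONE explicit integer symmetric 9×9 pencil with exponents `d = (0, 70, 71, 130, 574)`,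
i.e. `¬ PosRootLawAt 9 5 111` (kit Part 2G `…CensusReflectGaussChunks :: glue_chunkCheckG` + Part 2 `not_posRootLawAt_of_le_card_Ioo`;
the letters' symmetry is the closed check `symmB … = true`).  A GRID-v2 cell of val-V1-extremal (extension along m at K = 5): previous kernel
value `(9,5) ≥ 108` (graft law m²+3m).  Nothing is claimed about the asymptotic crux `Theses.LacunarySymmetroid.MatrixDescartes`
(stmt-ValiantsHypothesis-18050) nor about `VP ≠ VNP`.

Source record: `E2G0-GAPFLAG112-9-5-0-70-71-130-574` (val-v1x-eng-2 g0; conjb-3 gap-flag mechanism on the explicit (9,4) tower; two codes at eng-2);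
single-file certificate data by val-v1x-eng-8 g0 (sha16 `ef556f5e514ad9e2`); chunking val-v1x-eng-10 g2.  Generated 2026-08-28T23:10Z.
[folklore] Descartes / intermediate value theorem; certificate by kernel reflection.
-/

-- `Summit.ValiantsHypothesis.ValiantsHypothesis.…` repeats a component by the D-0017 layout
-- (single-conjunct summit), which the `dupNamespace` linter flags; the name is mandated.
set_option linter.dupNamespace false

namespace Summit.ValiantsHypothesis.ValiantsHypothesis.Theorems.LacunarySymmetroidMatrixDescartes.Census.Reflect

open Summit.ValiantsHypothesis.ValiantsHypothesis.Theorems.MatrixDescartes.Negative (PosRootLawAt)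

set_option maxHeartbeats 4000000 in
/-- **`ζ_sym(9,5) ≥ 112`** (record `E2G0-GAPFLAG112-9-5-0-70-71-130-574`): 112 distinct positive roots glued from 6 Gaussian chunks. [folklore] -/
theorem gapflag112_not_posRootLawAt_9_5_111 : ¬ PosRootLawAt 9 5 111 := by
  have l1 := ptR_lt_of_chunkCheckG gapflag112_not_posRootLawAt_9_5_111_c1
  have g1 := le_card_Ioo_of_chunkCheckG gapflag112_not_posRootLawAt_9_5_111_c1
  have s2 := glue_chunkCheckG l1 g1 gapflag112_not_posRootLawAt_9_5_111_c2
  have s3 := glue_chunkCheckG s2.1 s2.2 gapflag112_not_posRootLawAt_9_5_111_c3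
  have s4 := glue_chunkCheckG s3.1 s3.2 gapflag112_not_posRootLawAt_9_5_111_c4
  have s5 := glue_chunkCheckG s4.1 s4.2 gapflag112_not_posRootLawAt_9_5_111_c5
  have s6 := glue_chunkCheckG s5.1 s5.2 gapflag112_not_posRootLawAt_9_5_111_c6
  exact not_posRootLawAt_of_le_card_Ioo (by decide +kernel) (ptR_pos_of_chunkCheckG gapflag112_not_posRootLawAt_9_5_111_c1).le s6.2 (by norm_num)

end Summit.ValiantsHypothesis.ValiantsHypothesis.Theorems.LacunarySymmetroidMatrixDescartes.Census.Reflect
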